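import Summits.ValiantsHypothesis.ValiantsHypothesis.Theorems.KPlusLogSqLawTropicalShiftThree

/-!
# Route «KPlusLogSqLaw» — SHIFT-THREE, part 2: dominance, signs, the chain; the `K = 3` tropical row from below

HONEST FRAMING.  Second proof file (pure theorems) of the helper chain toward the registered stub `stub_liftRungThree` of
the crux `Summit.ValiantsHypothesis.ValiantsHypothesis.Theses.KPlusLogSqLaw.Lifting` (item `stmt-ValiantsHypothesis-19772`,
route `KPlusLogSqLaw`, cell `pub-symmetroid`, seat val-sym-lift-p3, 2026-08-26); design in `…TropicalShiftThreeDefs.lean`,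
per-entry inequalities in `…TropicalShiftThree.lean`.  Proved here, sorry-free:
* `ShiftThree.isDominant_cterm`: for `p < m`, `a ≤ m − p` the grid term `(σ_p, λ_{p,a})` is the UNIQUE optimum at the
  integer slope `θ(p,a)` among all `m!·3^m` Leibniz terms (entrywise domination with a strict entry, `Finset.sum_lt_sum`);
* `ShiftThree.termSign_cterm`: its sign is `(−1)^{T p + a}` (`T p = Σ_{p'<p}(m − p' + 1)` the rank of `(p,0)`): the `a`
  class-`1` entries give `(−1)^a` and the last-column sign `phaseSign p = (−1)^{T p}·sign σ_p` cancels `sign σ_p`;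
* the grid enumerated recursively (`grid`: `(p,a) ↦ (p,a+1)` while `a + p < m`, else `(p+1,0)`) satisfies the rank
  identity `T p_k + a_k = k` (`grid_inv`), has strictly increasing slopes (`th_grid_lt`) and signs `(−1)^k`
  (`termSign_grid`), and `T m = C(m+2,2) − 1` (`two_mul_T`, `T_last`);
* **`choose_sub_two_le_of_tropRootLawAt_three : TropRootLawAt m 3 B → C(m+2,2) − 2 ≤ B`** for every `m` — the
  `K = 3` tropical census row is counting-tight minus one from below (the slope count gives `≤ C(m+2,2) − 1`,
  `tropRootLawAt_choose`; the cell's «TightnessThree»).  With the real Descartes ceiling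
  `Census.realRootLawAt_descartes` (`ζ(m,3) ≤ 2·C(m+2,2) − 1`) format-level lifting at `K = 3` is then free
  (`2·C(m+2,2) − 1 ≤ 2^9·(C(m+2,2) − 1)`): that is the stub `stub_liftRungThree`, landed separately.
Nothing here bears on `Lifting` / `TropicalB` inside their window, on `MatrixDescartes` or on `VP ≠ VNP`.
-/

set_option linter.dupNamespace false
set_option autoImplicit false

namespace Summit.ValiantsHypothesis.ValiantsHypothesis.Theorems.LacunarySymmetroidMatrixDescartes.TropicalCensus

open Summit.ValiantsHypothesis.ValiantsHypothesis.Theorems.MatrixDescartes.Negative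
open scoped BigOperators
open Finset

namespace ShiftThree

variable (n : ℕ)

/-- **per-entry domination**: at `θ(p,a)` every present entry of column `b` scores at most the grid term's entry … -/
theorem phi_le (p a : ℕ) (hp : p ≤ n) (ha : a + p ≤ n + 1) (a' b : Fin (n + 1)) (l : Fin 3)
    (h : ee n a' b l ≠ 0) :
    phi n (th n p a) a' b l ≤ phi n (th n p a) (rot n p b) b (lam n p a b) := by
  rw [phi_present n _ a' b l h, phi_cterm n _ p a hp ha b]
  set q := shiftZ n a' b with hq
  rcases lt_trichotomy q p with hlt | heq | hgt
  · have h1 := gval_gap_of_lt n p a q hlt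
    have h2 := bonus_le_of_lt n p a b l q hlt
    linarith
  · rw [heq]
    have h2 := bonus_le_of_eq n p a b l
    linarith
  · have h1 := gval_gap_of_gt n p a ha q hgt
    have h2 := bonus_le_of_gt n p a b l q hgt
    linarith

/-- … and strictly less unless it IS the grid term's entry. -/
theorem phi_lt (p a : ℕ) (hp : p ≤ n) (ha : a + p ≤ n + 1) (a' b : Fin (n + 1)) (l : Fin 3)
    (h : ee n a' b l ≠ 0) (hne : a' ≠ rot n p b ∨ l ≠ lam n p a b) :
    phi n (th n p a) a' b l < phi n (th n p a) (rot n p b) b (lam n p a b) := by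
  rw [phi_present n _ a' b l h, phi_cterm n _ p a hp ha b]
  set q := shiftZ n a' b with hq
  rcases lt_trichotomy q p with hlt | heq | hgt
  · have h1 := gval_gap_of_lt n p a q hlt
    have h2 := bonus_le_of_lt n p a b l q hlt
    linarith
  · -- same shift: same entry, so the class differs
    have ha' : a' = rot n p b := eq_rot_of_shiftZ_eq n p hp a' b heq
    have hl : l ≠ lam n p a b := by
      rcases hne with h1 | h1
      · exact absurd ha' h1
      · exact h1
    rw [heq]
    have ht := th_sub_price n p a b
    -- the entry is present with class `l`; read off which classes are present
    subst ha'
    have hv := rot_val n p hp b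
    unfold ee at h
    unfold lam at hl
    by_cases hw : n + 1 ≤ (b : ℕ) + p
    · exfalso
      rw [if_pos hw] at hv
      have hlt' : ((rot n p b : Fin (n + 1)) : ℕ) < (b : ℕ) := by rw [hv]; omega
      rw [if_pos hlt'] at h
      rw [if_pos hw] at hl
      by_cases hl2 : l = 2
      · exact hl hl2
      · exact h (by rw [if_neg hl2])
    · rw [if_neg hw] at hv
      have hlt' : ¬ ((rot n p b : Fin (n + 1)) : ℕ) < (b : ℕ) := by rw [hv]; omega
      rw [if_neg hlt'] at h
      rw [if_neg hw] at hl
      by_cases hb : (b : ℕ) < a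
      · rw [if_pos hb] at hl
        rw [if_neg hl, if_pos hb]
        have : (b : ℤ) + 1 ≤ a := by exact_mod_cast hb
        linarith
      · rw [if_neg hb] at hl
        have hl1 : l = 1 := by
          rcases (by fin_cases l <;> simp : l = 0 ∨ l = 1 ∨ l = 2) with rfl | rfl | rfl
          · exact absurd rfl hl
          · rfl
          · exfalso; exact h (by rw [if_neg (by decide), if_neg (by decide)])
        rw [if_pos hl1, if_neg hb]
        have : (a : ℤ) ≤ b := by exact_mod_cast Nat.le_of_not_lt hb
        linarith
  · have h1 := gval_gap_of_gt n p a ha q hgt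
    have h2 := bonus_le_of_gt n p a b l q hgt
    linarith


/-! ### dominance and signs of the grid terms -/

/-- `|phaseSign p| = 1`. -/
theorem phaseSign_natAbs (p : ℕ) : (phaseSign n p).natAbs = 1 := by
  unfold phaseSign
  rw [Int.natAbs_mul, Int.natAbs_pow, Int.natAbs_neg, Int.natAbs_one, one_pow, one_mul, Int.units_natAbs]

/-- the design's signs lie in `{−1, 0, 1}`. -/
theorem ee_natAbs (a b : Fin (n + 1)) (l : Fin 3) : (ee n a b l).natAbs ≤ 1 := by
  unfold ee
  split_ifs <;> simp [phaseSign_natAbs]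

/-- **the grid term `(σ_p, λ_{p,a})` is the unique optimum at `θ(p,a)`.** -/
theorem isDominant_cterm (p a : ℕ) (hp : p ≤ n) (ha : a + p ≤ n + 1) :
    IsDominant (dd n) (vv n) (ee n) (th n p a) (cterm n p a) := by
  refine ⟨?_, ?_⟩
  · unfold termSign cterm
    refine mul_ne_zero (Units.ne_zero _) ?_
    rw [Finset.prod_ne_zero_iff]
    intro b _
    exact ee_cterm_ne_zero n p a hp ha b
  · intro q hq hqs
    rw [tropWeight_eq_sum_phi, tropWeight_eq_sum_phi]
    have hpres : ∀ b, ee n (q.1 b) b (q.2 b) ≠ 0 := by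
      intro b
      unfold termSign at hqs
      exact (Finset.prod_ne_zero_iff.mp (right_ne_zero_of_mul hqs)) b (Finset.mem_univ b)
    obtain ⟨b₀, hb₀⟩ : ∃ b, q.1 b ≠ rot n p b ∨ q.2 b ≠ lam n p a b := by
      by_contra hcon
      push Not at hcon
      apply hq
      unfold cterm
      exact Prod.ext (Equiv.ext fun b => (hcon b).1) (funext fun b => (hcon b).2)
    unfold cterm
    exact Finset.sum_lt_sum (fun b _ => phi_le n p a hp ha (q.1 b) b (q.2 b) (hpres b))
      ⟨b₀, Finset.mem_univ _, phi_lt n p a hp ha (q.1 b₀) b₀ (q.2 b₀) (hpres b₀) hb₀⟩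

/-- `sign σ · sign σ = 1` in `ℤ`. -/
theorem sign_mul_self (σ : Equiv.Perm (Fin (n + 1))) :
    ((Equiv.Perm.sign σ : ℤˣ) : ℤ) * ((Equiv.Perm.sign σ : ℤˣ) : ℤ) = 1 := by
  rcases Int.units_eq_one_or (Equiv.Perm.sign σ) with h | h <;> simp [h]

/-- `∏_{b < m} [b < a ? −1 : 1] = (−1)^a`. -/
theorem prod_neg_one_pow (a : ℕ) (ha : a ≤ n + 1) :
    ∏ b : Fin (n + 1), (if (b : ℕ) < a then (-1 : ℤ) else 1) = (-1) ^ a := by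
  rw [Fin.prod_univ_eq_prod_range (fun i => if i < a then (-1 : ℤ) else 1) (n + 1)]
  rw [← Finset.prod_range_mul_prod_Ico _ ha]
  rw [Finset.prod_congr rfl (fun i hi => if_pos (Finset.mem_range.mp hi)),
    Finset.prod_congr rfl (fun i hi => if_neg (not_lt.mpr (Finset.mem_Ico.mp hi).1))]
  simp

/-- a product supported on the last column. -/
theorem prod_lastColumn (p : ℕ) :
    ∏ b : Fin (n + 1), (if (b : ℕ) = n ∧ p ≠ 0 then phaseSign n p else (1 : ℤ)) =
      if p ≠ 0 then phaseSign n p else 1 := by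
  have h1 : ∀ b : Fin (n + 1), (if (b : ℕ) = n ∧ p ≠ 0 then phaseSign n p else (1 : ℤ))
      = if b = Fin.last n then (if p ≠ 0 then phaseSign n p else 1) else 1 := by
    intro b
    by_cases hb : b = Fin.last n
    · subst hb
      rw [if_pos rfl, Fin.val_last]
      by_cases hp : p ≠ 0
      · rw [if_pos ⟨rfl, hp⟩, if_pos hp]
      · rw [if_neg (fun h => hp h.2), if_neg hp]
    · have hb' : (b : ℕ) ≠ n := fun h => hb (Fin.ext (by rw [h, Fin.val_last]))
      rw [if_neg (fun h => hb' h.1), if_neg hb]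
  rw [Finset.prod_congr rfl (fun b _ => h1 b), Finset.prod_ite_eq']
  simp

/-- phase `0` is the identity permutation. -/
theorem rot_zero : rot n 0 = 1 := by
  apply Equiv.ext
  intro b
  apply Fin.ext
  rw [rot_val n 0 (Nat.zero_le _), Equiv.Perm.coe_one, id_eq]
  have := b.isLt
  rw [if_neg (by omega), Nat.add_zero]

/-- **sign of the grid term**: `(−1)^{T p + a}`. -/
theorem termSign_cterm (p a : ℕ) (hp : p ≤ n) (ha : a + p ≤ n + 1) :
    termSign (ee n) (cterm n p a) = (-1) ^ (T n p + a) := by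
  unfold termSign cterm
  dsimp only
  rw [Finset.prod_congr rfl (fun b _ => ee_cterm n p a hp ha b), Finset.prod_mul_distrib,
    prod_neg_one_pow n a (by omega), prod_lastColumn, pow_add]
  by_cases hp0 : p ≠ 0
  · rw [if_pos hp0]
    unfold phaseSign
    have hs := sign_mul_self n (rot n p)
    linear_combination ((-1 : ℤ) ^ a * (-1) ^ T n p) * hs
  · rw [if_neg hp0]
    have hp0' : p = 0 := by
      by_contra h; exact hp0 h
    subst hp0'
    rw [rot_zero, Equiv.Perm.sign_one]
    simp [T]

/-! ### the chain: lexicographic enumeration of the grid -/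

/-- the grid starts at `(0, 0)`. -/
theorem grid_zero : grid n 0 = (0, 0) := rfl

/-- one step of the enumeration. -/
theorem grid_succ (k : ℕ) : grid n (k + 1) = step n (grid n k) :=
  Function.iterate_succ_apply' _ _ _

/-- the rank recursion. -/
theorem T_succ (p : ℕ) : T n (p + 1) = T n p + (n + 1 - p + 1) := rfl

/-- the rank function is monotone. -/
theorem T_mono {p p' : ℕ} (h : p ≤ p') : T n p ≤ T n p' := by
  induction p' with
  | zero =>
    have : p = 0 := Nat.le_zero.mp h
    subst this; exact le_rfl
  | succ p' ih =>
    rcases Nat.lt_or_eq_of_le h with h1 | h1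
    · exact (ih (Nat.lt_succ_iff.mp h1)).trans (by rw [T_succ]; omega)
    · rw [h1]

/-- the grid invariant: `a_k + p_k ≤ m` and the rank identity `T p_k + a_k = k`, up to the end of the grid. -/
theorem grid_inv (k : ℕ) (hk : k ≤ T n (n + 1)) :
    (grid n k).2 + (grid n k).1 ≤ n + 1 ∧ T n (grid n k).1 + (grid n k).2 = k := by
  induction k with
  | zero => simp [grid_zero, T]
  | succ k ih =>
    obtain ⟨h1, h2⟩ := ih (Nat.le_of_succ_le hk)
    rw [grid_succ]
    unfold step
    by_cases h : (grid n k).2 + (grid n k).1 < n + 1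
    · rw [if_pos h]
      exact ⟨by dsimp only; omega, by dsimp only; omega⟩
    · rw [if_neg h]
      have hpa : (grid n k).2 + (grid n k).1 = n + 1 := le_antisymm h1 (not_lt.mp h)
      have hp : (grid n k).1 ≤ n := by
        by_contra hcon
        have hp' : (grid n k).1 = n + 1 := by omega
        rw [hp'] at h2
        omega
      refine ⟨by dsimp only; omega, ?_⟩
      dsimp only
      rw [T_succ]
      omega

/-- inside the grid the phase is `< m`. -/
theorem grid_fst_le (k : ℕ) (hk : k < T n (n + 1)) : (grid n k).1 ≤ n := by
  obtain ⟨_, h2⟩ := grid_inv n k hk.le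
  by_contra hcon
  have h3 := T_mono n (show n + 1 ≤ (grid n k).1 by omega)
  omega

/-- the slopes increase along the grid. -/
theorem th_grid_lt (k : ℕ) (hk : k + 1 ≤ T n (n + 1)) :
    th n (grid n k).1 (grid n k).2 < th n (grid n (k + 1)).1 (grid n (k + 1)).2 := by
  obtain ⟨h1, _⟩ := grid_inv n k (Nat.le_of_succ_le hk)
  rw [grid_succ]
  unfold step th
  by_cases h : (grid n k).2 + (grid n k).1 < n + 1
  · rw [if_pos h]; dsimp only; push_cast; linarith
  · rw [if_neg h]; dsimp only; push_cast
    have : ((grid n k).2 : ℤ) + (grid n k).1 ≤ n + 1 := by exact_mod_cast h1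
    nlinarith

/-- the term signs alternate along the grid: the `k`-th sign is `(−1)^k`. -/
theorem termSign_grid (k : ℕ) (hk : k < T n (n + 1)) :
    termSign (ee n) (cterm n (grid n k).1 (grid n k).2) = (-1) ^ k := by
  obtain ⟨h1, h2⟩ := grid_inv n k hk.le
  rw [termSign_cterm n _ _ (grid_fst_le n k hk) h1, h2]

/-- closed form of the rank function: `2·T p = p·(2m + 3 − p)`. -/
theorem two_mul_T (p : ℕ) (hp : p ≤ n + 2) : 2 * T n p + p * p = p * (2 * n + 5) := by
  induction p with
  | zero => simp [T]
  | succ p ih =>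
    have ih' := ih (by omega)
    have hp' : p ≤ n + 1 := by omega
    rw [T_succ]
    zify [hp'] at ih' ⊢
    linear_combination ih'

/-- the grid has `C(m+2, 2) − 1` points. -/
theorem T_last : T n (n + 1) + 1 = (n + 3).choose 2 := by
  have h := two_mul_T n (n + 1) (by omega)
  rw [Nat.choose_two_right, show n + 3 - 1 = n + 2 by omega]
  symm
  apply Nat.div_eq_of_eq_mul_left (by norm_num)
  nlinarith [h]

/-- **the tropical row `(m, 3)`, `m = n + 1`, is at least `C(m+2,2) − 2`.** -/
theorem le_of_tropRootLawAt_three_succ (B : ℕ) (h : TropRootLawAt (n + 1) 3 B) : T n (n + 1) - 1 ≤ B := by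
  have hT1 : 1 ≤ T n (n + 1) := by rw [T_succ]; omega
  have hmain := h (dd n) (vv n) (ee n) (T n (n + 1) - 1) (fun k => th n (grid n k).1 (grid n k).2)
    (fun k => cterm n (grid n k).1 (grid n k).2) (ee_natAbs n) ?_ ?_ ?_
  · exact hmain
  · refine Fin.strictMono_iff_lt_succ.mpr fun k => ?_
    simp only [Fin.val_castSucc, Fin.val_succ]
    exact th_grid_lt n k (by omega)
  · intro k
    obtain ⟨h1, _⟩ := grid_inv n k (by omega)
    exact isDominant_cterm n _ _ (grid_fst_le n k (by omega)) h1
  · intro k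
    simp only [Fin.val_castSucc, Fin.val_succ]
    rw [termSign_grid n k (by omega), termSign_grid n (k + 1) (by omega), ← pow_add,
      show (k : ℕ) + (k + 1) = 2 * k + 1 by ring, pow_succ, pow_mul]
    norm_num

end ShiftThree

/-- **The `K = 3` tropical census row is counting-tight minus one from below:** every bound `B` of the tropical
row `(m, 3)` satisfies `C(m+2, 2) − 2 ≤ B` — the explicit SHIFT-THREE design has `C(m+2,2) − 1` sign-alternating
unique optima (the slope count allows at most `C(m+2,2)`, `tropRootLawAt_choose`). -/
theorem choose_sub_two_le_of_tropRootLawAt_three (m B : ℕ) (h : TropRootLawAt m 3 B) :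
    (m + 2).choose 2 - 2 ≤ B := by
  rcases m with _ | n
  · simp
  · have h1 := ShiftThree.le_of_tropRootLawAt_three_succ n B h
    have h2 := ShiftThree.T_last n
    have h3 : n + 1 + 2 = n + 3 := rfl
    rw [h3]
    omega

end Summit.ValiantsHypothesis.ValiantsHypothesis.Theorems.LacunarySymmetroidMatrixDescartes.TropicalCensus
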